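import Literature.NumberTheory.EllipticCurves.ZpExtensionGaloisTwist
import Literature.NumberTheory.EllipticCurves.IwasawaAlgebraEisensteinFiniteQuotientProofs
import Literature.NumberTheory.GaloisRepresentations.ContinuousRepCoeffExtension
import HarnessLib

/-!
# The twist `M ⊗ 𝒪(χ_u)` of a discrete Galois module by an `𝒪ˣ`-valued character of a `ℤ_p`-extension,
# and Howard's specialised modules `T_𝔮/p^k T_𝔮 = E[p^k] ⊗ Λ/(q_m, p^k)(ψ)` at the Eisenstein primes
# `𝔮 = (T^m + p)` (definitions with bodies + unfolding lemmas; no named fact, no instance, no notation)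

Topic `NumberTheory/EllipticCurves` (next to `ZpExtension`, `ZpExtensionGaloisTwist`, `IwasawaTwistModP`).

For a `ℤ_p`-extension `κ : Γ_K →ₜ* ℤ_p` (`ZpExtension K p`), a commutative coefficient ring `𝒪` and an element
`u ∈ 𝒪` acting with `p`-power order on an `𝒪`-module (`u^{p^J} · x = x`), the character
`χ_u : Γ_K → 𝒪ˣ`, `σ ↦ u^{κ(σ)}`, makes sense on that module through `u^{κ(σ) mod p^J}`
(`ZpExtension.twistExponent κ J σ ∈ [0, p^J)`, file `IwasawaTwistModP`). This is the tree's
`ZpExtension.galoisTwist` (file `ZpExtensionGaloisTwist`, where `𝒪 = ℤ` and `u` is an integer `≡ 1 (mod p)`)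
with the integer replaced by a scalar of an arbitrary coefficient ring — the generality needed for the
"universal" anticyclotomic character `ψ : γ ↦ 1 + T` with values in a finite quotient of `Λ = ℤ_p⟦T⟧`.

## What is defined (namespace `Literature.NumberTheory.EllipticCurves`)

* `DiscreteGaloisModule.coeffExtension 𝒪 ρ : DiscreteGaloisModule K (CoeffExtension ℤ 𝒪 M)` — the discrete
  Galois module `𝒪 ⊗_ℤ M` with `σ ↦ 1 ⊗ ρ(σ)` (the `ℤ`-linear avatar of the tree's
  `ContinuousRep.extendScalars`, file `GaloisRepresentations/ContinuousRepCoeffExtension`, on the same carrier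
  `CoeffExtension ℤ 𝒪 M := 𝒪 ⊗[ℤ] M`; no topology on `𝒪` is needed); it is `𝒪`-linear
  (`coeffExtension_apply_smul`).
* `ZpExtension.scalarTwist κ ρ hlin J u hu : DiscreteGaloisModule K N` — for a discrete Galois module `ρ` on an
  `𝒪`-module `N` acting `𝒪`-linearly (`hlin`) and `u ∈ 𝒪` with `u^{p^J}` acting trivially (`hu`): the
  representation `σ ↦ u^{twistExponent κ J σ} • ρ(σ)`, i.e. `ρ ⊗ χ_u`; continuous because the stabiliser of `x`
  contains `Stab_ρ(x) ∩ Gal(K̄/K_J)`. Unfolding lemmas: `scalarTwist_apply_apply`; `Gal(K̄/K_J)` and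
  `Gal(K̄/K_∞) = ker κ` act through `ρ` (`…_of_mem_layerSubgroup`, `…_of_mem_kerSubgroup`); a topological
  generator `γ` acts by `u • ρ(γ)` (`…_of_isTopGenerator`); the twist is `𝒪`-linear (`scalarTwist_apply_smul`)
  and independent of the auxiliary exponent level `J` (`scalarTwist_apply_eq_of_le`).
* `IwasawaAlgebra.EisensteinCoeff p m k := Λ ⧸ ((T^m + p) ⊔ (p^k))` — the FINITE coefficient ring `A_{m,k}`
  of [Howard 2004, §2.2, proof of Thm. 2.2.10 ("taking `𝔮 = T^m + p`")]: `T_𝔮 = 𝐓 ⊗_Λ S_𝔮`, `S_𝔮 = Λ/𝔮`,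
  `T_𝔮/p^k T_𝔮 = E[p^k] ⊗ A_{m,k}(ψ)`; an `abbrev` of the quotient ring (all structure inherited), with
  `EisensteinCoeff.onePlusT p m k` (the class of `1 + T`), `EisensteinCoeff.natCast_pow_smul_eq_zero` (`p^k`
  kills every `A_{m,k}`-module), `EisensteinCoeff.exists_onePlusT_pow_prime_pow_eq_one` /
  `…exists_onePlusT_pow_smul_eq` (`∃ J, (1+T)^{p^J} = 1`, the tree's
  `IwasawaAlgebra.exists_mk_onePlusX_pow_prime_pow_eq_one`), and the CARRIER
  `EisensteinCoeff.Twisted p m k M` (`= CoeffExtension ℤ A_{m,k} M = A_{m,k} ⊗_ℤ M` with the `ℤ`-algebra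
  structure of `A_{m,k}` pinned to the generic `Ring.toIntAlgebra` — the spelling to use), its pure tensors
  `Twisted.tmul c a`, `Twisted.smul_tmul`, `Twisted.induction_on`.
* **`ZpExtension.eisensteinTwist κ ρ hm k : DiscreteGaloisModule K (EisensteinCoeff.Twisted p m k M)`**
  — the module `M ⊗ A_{m,k}(ψ)`, `ψ(σ) = (1+T)^{κ(σ)}`: the scalar twist of `coeffExtension A_{m,k} ρ` by
  `u = 1 + T` at the exponent level `ZpExtension.eisensteinLevel hm k` (any level works,
  `scalarTwist_apply_eq_of_le`). For `M = E[p^k]` (`WeierstrassCurve.torsionGaloisModule`) this is Howard's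
  `T_𝔮/p^k T_𝔮` with `𝔮 = (T^m + p)`, the Galois module whose Selmer groups `H¹_{F_𝔮}(K, ·)` carry the
  specialised Kolyvagin system at the Eisenstein prime [Howard 2004, Def. 2.2.3, Lemma 2.2.7, Prop. 2.2.8;
  Mazur–Rubin 2004, §5.3]. Unfolding lemmas: action on pure tensors (`eisensteinTwist_apply_tmul`), through
  `ρ` on `ker κ` (`…_apply_tmul_of_mem_kerSubgroup`, `…_apply_eq_self_of_mem_kerSubgroup`) and through
  `1 ⊗ ρ` on `Gal(K̄/K_J)` (`…_apply_of_mem_layerSubgroup`), `γ` acts by `(1+T) ⊗ ρ(γ)`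
  (`…_apply_tmul_of_isTopGenerator`), `A_{m,k}`-linearity (`eisensteinTwist_apply_smul`), `p^k`-torsion
  (`prime_pow_smul_eisensteinTwist_carrier`).

DEFINITIONS WITH BODIES and unfolding lemmas only; nothing is asserted about any curve, Selmer group or
`L`-function; no instance (the carrier's instances are those of the tree's `CoeffExtension`), no notation, no
`sorry`. Not here (next files of the D1 road, cell `pub/bsd-print-x9`, memo PORT-ALGEBRA-LAYER §5): the Selmer
structure `F_𝔮` on `E[p^k] ⊗ A_{m,k}(ψ)` (ordinary at `v ∣ p`, unramified elsewhere), the compact module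
`H = lim_k H¹_{F_𝔮}(K, T_𝔮/p^k)` and its control maps. BSD is not proved by any of this.

References: [Howard2004HeegnerKolyvagin] B. Howard, *The Heegner point Kolyvagin system*, Compositio Math. 140
(2004), §2.2 (`𝐓 = T_p(E) ⊗ Λ` with `Γ_K` acting on `Λ` through `γ ↦ γ`; `T_𝔮 = 𝐓 ⊗_Λ S_𝔮`), Def. 2.2.3,
Lemma 2.2.7, Prop. 2.2.8, proof of Thm. 2.2.10; [MazurRubinMemoirs2004] B. Mazur, K. Rubin,
*Kolyvagin systems*, Mem. AMS 799 (2004), §5.3 (`T ⊗ Λ`, specialisations at height-one primes);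
[GreenbergLNM1716] R. Greenberg, *Iwasawa theory for elliptic curves*, LNM 1716 (1999), §4 p. 105 (the twisted
modules `A_s = E[p^∞] ⊗ κ^s`); [Washington1997] §13.1–§13.2; [SerreGaloisCohomology1997] I §2.1 (discrete
modules: open stabilisers).
-/

noncomputable section

open scoped TensorProduct Topology
open Field Filter

universe u v w

namespace Literature.NumberTheory.EllipticCurves

open Literature.NumberTheory.GaloisRepresentations

/-! ## §1 The discrete Galois module `𝒪 ⊗_ℤ M`, `σ ↦ 1 ⊗ ρ(σ)` -/

namespace DiscreteGaloisModule

-- The carrier `CoeffExtension ℤ 𝒪 M` is formed with the GENERIC `ℤ`-algebra structure `Ring.toIntAlgebra 𝒪`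
-- (the only one available for a variable ring `𝒪`); for a concrete quotient ring `𝒪 = Λ ⧸ I` instance
-- resolution may produce `Ideal.instAlgebraQuotient` instead (propositionally, not syntactically, equal), so
-- §3 pins the generic structure in the abbreviation `IwasawaAlgebra.EisensteinCoeff.Twisted`, which is the
-- spelling to use for Howard's modules.
variable {K : Type u} [Field K] (𝒪 : Type v) [CommRing 𝒪] {M : Type w} [AddCommGroup M]
  [TopologicalSpace M] [DiscreteTopology M]

/-- The `ℤ`-linear representation `σ ↦ 1 ⊗ ρ(σ)` of `Γ_K` on `𝒪 ⊗_ℤ M` (Mathlib `LinearMap.lTensor`), for a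
discrete Galois module `ρ` on `M` and a commutative ring `𝒪`; the algebraic part of `coeffExtension`.
[cite: Howard2004HeegnerKolyvagin, §2.2 (T_𝔮 = 𝐓 ⊗_Λ S_𝔮)] [cite: SerreGaloisCohomology1997, I §2.1] -/
def coeffExtensionRepresentation (ρ : DiscreteGaloisModule K M) :
    Representation ℤ (absoluteGaloisGroup K) (CoeffExtension ℤ 𝒪 M) where
  toFun σ := ((ρ σ).lTensor 𝒪 : 𝒪 ⊗[ℤ] M →ₗ[ℤ] 𝒪 ⊗[ℤ] M)
  map_one' := by
    change ((ρ 1).lTensor 𝒪 : 𝒪 ⊗[ℤ] M →ₗ[ℤ] 𝒪 ⊗[ℤ] M) = LinearMap.id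
    rw [map_one, Module.End.one_eq_id, LinearMap.lTensor_id]
  map_mul' σ τ := by
    change ((ρ (σ * τ)).lTensor 𝒪 : 𝒪 ⊗[ℤ] M →ₗ[ℤ] 𝒪 ⊗[ℤ] M) = (ρ σ).lTensor 𝒪 * (ρ τ).lTensor 𝒪
    rw [map_mul, LinearMap.lTensor_mul]

/-- Unfolding on pure tensors: `(1 ⊗ ρ)(σ)(c ⊗ a) = c ⊗ ρ(σ) a`. [cite: Howard2004HeegnerKolyvagin, §2.2] -/
theorem coeffExtensionRepresentation_apply_tmul (ρ : DiscreteGaloisModule K M) (σ : absoluteGaloisGroup K)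
    (c : 𝒪) (a : M) :
    coeffExtensionRepresentation 𝒪 ρ σ (CoeffExtension.tmul c a) = CoeffExtension.tmul c (ρ σ a) :=
  LinearMap.lTensor_tmul _ _ _ _

/-- **The discrete Galois module `𝒪 ⊗_ℤ M`** (`σ ↦ 1 ⊗ ρ(σ)`) attached to a discrete Galois module `M` and a
commutative coefficient ring `𝒪`: continuous for the discrete topology because the stabiliser of a finite sum
of pure tensors `∑ cᵢ ⊗ aᵢ` contains the open subgroup `⋂ Stab_ρ(aᵢ)` (tensor induction;
`ContinuousRep.ofStabilizerMemNhdsOne`). The `ℤ`-linear avatar of the tree's `ContinuousRep.extendScalars`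
on the same carrier (no topology on `𝒪` required), so that the tree's `galoisCohomology`, localisations and
Selmer structures apply to it. [cite: Howard2004HeegnerKolyvagin, §2.2 (𝐓 = T_p(E) ⊗ Λ, T_𝔮 = 𝐓 ⊗_Λ S_𝔮)]
[cite: SerreGaloisCohomology1997, I §2.1 (discrete modules)] -/
def coeffExtension (ρ : DiscreteGaloisModule K M) : DiscreteGaloisModule K (CoeffExtension ℤ 𝒪 M) :=
  ContinuousRep.ofStabilizerMemNhdsOne (coeffExtensionRepresentation 𝒪 ρ) fun x ↦ by
    induction x using CoeffExtension.induction_on with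
    | zero => exact Filter.univ_mem' fun g ↦ map_zero _
    | tmul c a =>
      refine Filter.mem_of_superset ((ρ.isOpen_setOf_apply_eq a).mem_nhds (by simp)) fun g hg ↦ ?_
      simp only [Set.mem_setOf_eq] at hg ⊢
      rw [coeffExtensionRepresentation_apply_tmul, hg]
    | add x y hx hy =>
      refine Filter.mem_of_superset (Filter.inter_mem hx hy) fun g hg ↦ ?_
      simp only [Set.mem_inter_iff, Set.mem_setOf_eq] at hg ⊢
      rw [map_add, hg.1, hg.2]

variable (ρ : DiscreteGaloisModule K M)

/-- Unfolding `coeffExtension` on pure tensors: `σ · (c ⊗ a) = c ⊗ ρ(σ) a`. [cite: Howard2004HeegnerKolyvagin, §2.2] -/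
@[simp]
theorem coeffExtension_apply_tmul (σ : absoluteGaloisGroup K) (c : 𝒪) (a : M) :
    coeffExtension 𝒪 ρ σ (CoeffExtension.tmul c a) = CoeffExtension.tmul c (ρ σ a) :=
  coeffExtensionRepresentation_apply_tmul 𝒪 ρ σ c a

/-- **`Γ_K` acts `𝒪`-linearly on `𝒪 ⊗_ℤ M`**: `σ · (c • x) = c • (σ · x)` (the action is `1 ⊗ ρ(σ)`,
Mathlib `LinearMap.baseChange`). [cite: Howard2004HeegnerKolyvagin, §2.2 (T_𝔮 is an S_𝔮[Γ_K]-module)] -/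
theorem coeffExtension_apply_smul (σ : absoluteGaloisGroup K) (c : 𝒪) (x : CoeffExtension ℤ 𝒪 M) :
    coeffExtension 𝒪 ρ σ (c • x) = c • coeffExtension 𝒪 ρ σ x := by
  have h := ((ρ σ).baseChange 𝒪).map_smul c (x : 𝒪 ⊗[ℤ] M)
  rw [LinearMap.baseChange_eq_ltensor] at h
  exact h

/-- An element acting trivially on `M` acts trivially on `𝒪 ⊗_ℤ M`. [cite: SerreGaloisCohomology1997, I §2.1] -/
theorem coeffExtension_apply_eq_self {σ : absoluteGaloisGroup K} (hσ : ∀ a : M, ρ σ a = a)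
    (x : CoeffExtension ℤ 𝒪 M) : coeffExtension 𝒪 ρ σ x = x := by
  induction x using CoeffExtension.induction_on with
  | zero => exact map_zero _
  | tmul c a => rw [coeffExtension_apply_tmul, hσ]
  | add x y hx hy => rw [map_add, hx, hy]

end DiscreteGaloisModule

/-! ## §2 The scalar twist `ρ ⊗ χ_u`, `χ_u(σ) = u^{κ(σ)}`, for `u ∈ 𝒪` of `p`-power order on the module -/

namespace ZpExtension

variable {K : Type u} [Field K] {p : ℕ} [Fact p.Prime] (κ : ZpExtension K p)
  {𝒪 : Type v} [CommRing 𝒪] {N : Type w} [AddCommGroup N] [Module 𝒪 N] [TopologicalSpace N]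
  [DiscreteTopology N]

omit [Fact p.Prime] [TopologicalSpace N] [DiscreteTopology N] in
/-- If `u^{p^J}` acts trivially then the action of `u^a` depends only on `a mod p^J`.
[cite: Washington1997, §13.1–§13.2] -/
theorem pow_mod_smul_eq_pow_smul {u : 𝒪} {J : ℕ} (hu : ∀ x : N, u ^ (p ^ J) • x = x) (a : ℕ) (x : N) :
    u ^ (a % p ^ J) • x = u ^ a • x := by
  have hk : ∀ k : ℕ, (u ^ (p ^ J)) ^ k • x = x := fun k ↦ by
    induction k with
    | zero => rw [pow_zero, one_smul]
    | succ k ih => rw [pow_succ', mul_smul, ih, hu]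
  conv_rhs => rw [← Nat.mod_add_div a (p ^ J), pow_add, pow_mul, mul_smul, hk]

/-- **The scalar twist as a representation**: `σ ∈ Γ_K` acts on the `𝒪`-module `N` by
`u^{κ(σ) mod p^J} • ρ(σ)` (`twistExponent`), i.e. by `ρ(σ) ⊗ χ_u(σ)` with `χ_u(σ) = u^{κ(σ)} ∈ 𝒪ˣ`. A
homomorphism because `ρ(σ)` is `𝒪`-linear (`hlin`) and the exponent is additive modulo `p^J`, which acts
trivially (`hu`). For `𝒪 = ℤ` this is the tree's `galoisTwistRepresentation`; for `𝒪` a quotient of `Λ` and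
`u = 1 + T` it is Howard's `Λ`-adic twist `𝐓 = T ⊗ Λ`, `Γ_K` acting on `Λ` through `Γ_K ↠ Gal(K_∞/K) → Λˣ`,
reduced modulo an ideal. [cite: Howard2004HeegnerKolyvagin, §2.2 (definition of 𝐓 and T_𝔮)]
[cite: GreenbergLNM1716, §4 p. 105] [cite: Washington1997, §13.1–§13.2] -/
def scalarTwistRepresentation (ρ : DiscreteGaloisModule K N)
    (hlin : ∀ (σ : absoluteGaloisGroup K) (c : 𝒪) (x : N), ρ σ (c • x) = c • ρ σ x) (J : ℕ) (u : 𝒪)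
    (hu : ∀ x : N, u ^ (p ^ J) • x = x) : Representation ℤ (absoluteGaloisGroup K) N where
  toFun σ := (u ^ κ.twistExponent J σ) • ρ σ
  map_one' := by
    rw [twistExponent_one, pow_zero, one_smul, map_one]
  map_mul' σ τ := by
    refine LinearMap.ext fun x ↦ ?_
    rw [twistExponent_mul, map_mul, LinearMap.smul_apply, Module.End.mul_apply,
      pow_mod_smul_eq_pow_smul hu, Module.End.mul_apply, LinearMap.smul_apply, LinearMap.smul_apply,
      hlin, smul_smul, ← pow_add]

/-- Unfolding lemma for `scalarTwistRepresentation`. [cite: Washington1997, §13.1–§13.2] -/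
theorem scalarTwistRepresentation_apply_apply (ρ : DiscreteGaloisModule K N)
    (hlin : ∀ (σ : absoluteGaloisGroup K) (c : 𝒪) (x : N), ρ σ (c • x) = c • ρ σ x) (J : ℕ) (u : 𝒪)
    (hu : ∀ x : N, u ^ (p ^ J) • x = x) (σ : absoluteGaloisGroup K) (x : N) :
    κ.scalarTwistRepresentation ρ hlin J u hu σ x = (u ^ κ.twistExponent J σ) • ρ σ x := rfl

/-- **The scalar twist `N(χ_u) = N ⊗ 𝒪(χ_u)` as a DISCRETE `Γ_K`-MODULE**: the representation
`scalarTwistRepresentation` is continuous for the discrete topology, the stabiliser of `x` containing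
`Stab_ρ(x) ∩ Gal(K̄/K_J)` (`κ.layerSubgroup J`, open, acting through `ρ` since its exponent is `0`).
[cite: Howard2004HeegnerKolyvagin, §2.2 (T_𝔮 = 𝐓 ⊗_Λ S_𝔮)] [cite: GreenbergLNM1716, §4 p. 105]
[cite: SerreGaloisCohomology1997, I §2.1] -/
def scalarTwist (ρ : DiscreteGaloisModule K N)
    (hlin : ∀ (σ : absoluteGaloisGroup K) (c : 𝒪) (x : N), ρ σ (c • x) = c • ρ σ x) (J : ℕ) (u : 𝒪)
    (hu : ∀ x : N, u ^ (p ^ J) • x = x) : DiscreteGaloisModule K N :=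
  ContinuousRep.ofStabilizerMemNhdsOne (κ.scalarTwistRepresentation ρ hlin J u hu) fun x ↦ by
    have h1 : (κ.layerSubgroup J : Set (absoluteGaloisGroup K)) ∈ 𝓝 (1 : absoluteGaloisGroup K) :=
      (κ.isOpen_layerSubgroup J).mem_nhds (one_mem _)
    filter_upwards [h1, ρ.setOf_apply_eq_mem_nhds_one x] with σ hσ1 hσ2
    have hσ2' : ρ σ x = x := hσ2
    change (u ^ κ.twistExponent J σ) • ρ σ x = x
    rw [κ.twistExponent_eq_zero_of_mem_layerSubgroup hσ1, pow_zero, one_smul, hσ2']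

variable (ρ : DiscreteGaloisModule K N)
  (hlin : ∀ (σ : absoluteGaloisGroup K) (c : 𝒪) (x : N), ρ σ (c • x) = c • ρ σ x) (J : ℕ) (u : 𝒪)
  (hu : ∀ x : N, u ^ (p ^ J) • x = x)

/-- Unfolding lemma: `σ` acts on `N(χ_u)` by `u^{κ(σ) mod p^J} • ρ(σ)`. [cite: Washington1997, §13.1–§13.2] -/
theorem scalarTwist_apply_apply (σ : absoluteGaloisGroup K) (x : N) :
    κ.scalarTwist ρ hlin J u hu σ x = (u ^ κ.twistExponent J σ) • ρ σ x := rfl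

/-- **`Gal(K̄/K_J)` acts on `N(χ_u)` through `ρ` alone** (`χ_u ≡ 1` there modulo `p^J`).
[cite: Washington1997, §13.1–§13.2] -/
theorem scalarTwist_apply_of_mem_layerSubgroup {σ : absoluteGaloisGroup K} (hσ : σ ∈ κ.layerSubgroup J)
    (x : N) : κ.scalarTwist ρ hlin J u hu σ x = ρ σ x := by
  rw [scalarTwist_apply_apply, κ.twistExponent_eq_zero_of_mem_layerSubgroup hσ, pow_zero, one_smul]

/-- **`Gal(K̄/K_∞) = ker κ` acts on `N(χ_u)` through `ρ`**: as `G_{K_∞}`-modules `N(χ_u) = N`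
(Greenberg: «As `G_{F_∞}`-modules, `A_s = E[p^∞]`»; Howard: `𝐓 ≅ T_p(E) ⊗ Λ` as `G_{K_∞}`-modules).
[cite: GreenbergLNM1716, §4 p. 107] [cite: Howard2004HeegnerKolyvagin, §2.2] -/
theorem scalarTwist_apply_of_mem_kerSubgroup {σ : absoluteGaloisGroup K} (hσ : σ ∈ κ.kerSubgroup)
    (x : N) : κ.scalarTwist ρ hlin J u hu σ x = ρ σ x :=
  κ.scalarTwist_apply_of_mem_layerSubgroup ρ hlin J u hu (κ.kerSubgroup_le_layerSubgroup J hσ) x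

/-- **A topological generator `γ` (`κ γ = 1`) acts on `N(χ_u)` by `u • ρ(γ)`** — for `u = 1 + T` this is
Howard's "`γ` acts on `Λ` as multiplication by `γ = 1 + T`". (For `J = 0`, `hu` says `u` itself acts
trivially and both sides agree.) [cite: Howard2004HeegnerKolyvagin, §2.2 (Γ_K acts on Λ through Gal(K_∞/K))]
[cite: GreenbergLNM1716, §4 p. 107] -/
theorem scalarTwist_apply_of_isTopGenerator {γ : absoluteGaloisGroup K} (hγ : κ.IsTopGenerator γ) (x : N) :
    κ.scalarTwist ρ hlin J u hu γ x = u • ρ γ x := by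
  rcases Nat.eq_zero_or_pos J with rfl | hJ
  · have hu' : u • ρ γ x = ρ γ x := by simpa using hu (ρ γ x)
    rw [hu', scalarTwist_apply_apply, κ.twistExponent_eq_zero_of_mem_layerSubgroup (by
      rw [ZpExtension.layerSubgroup_zero]; exact Subgroup.mem_top γ), pow_zero, one_smul]
  · rw [scalarTwist_apply_apply, κ.twistExponent_eq_one_of_isTopGenerator hJ hγ, pow_one]

/-- **The twist is `𝒪`-linear**: `σ · (c • x) = c • (σ · x)` on `N(χ_u)` (`𝒪` commutative).
[cite: Howard2004HeegnerKolyvagin, §2.2 (T_𝔮 is an S_𝔮[Γ_K]-module)] -/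
theorem scalarTwist_apply_smul (σ : absoluteGaloisGroup K) (c : 𝒪) (x : N) :
    κ.scalarTwist ρ hlin J u hu σ (c • x) = c • κ.scalarTwist ρ hlin J u hu σ x := by
  rw [scalarTwist_apply_apply, scalarTwist_apply_apply, hlin, smul_comm]

/-- **Independence of the exponent level**: if `u^{p^J}` already acts trivially, computing the twist with
exponents modulo `p^{J'}` for any `J' ≥ J` gives the same action (`twistExponent J' ≡ twistExponent J`
modulo `p^J`). [cite: Washington1997, §13.1–§13.2] -/
theorem scalarTwist_apply_eq_of_le {J' : ℕ} (hJJ' : J ≤ J') (hu' : ∀ x : N, u ^ (p ^ J') • x = x)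
    (σ : absoluteGaloisGroup K) (x : N) :
    κ.scalarTwist ρ hlin J' u hu' σ x = κ.scalarTwist ρ hlin J u hu σ x := by
  rw [scalarTwist_apply_apply, scalarTwist_apply_apply, ← κ.twistExponent_mod_pow J' hJJ' σ,
    pow_mod_smul_eq_pow_smul hu]

/-- A point fixed by `σ ∈ ker κ` in the twisted module iff it is fixed in `N`. [cite: GreenbergLNM1716, §4 p. 107] -/
theorem scalarTwist_apply_eq_self_iff_of_mem_kerSubgroup {σ : absoluteGaloisGroup K}
    (hσ : σ ∈ κ.kerSubgroup) (x : N) : κ.scalarTwist ρ hlin J u hu σ x = x ↔ ρ σ x = x := by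
  rw [κ.scalarTwist_apply_of_mem_kerSubgroup ρ hlin J u hu hσ]

end ZpExtension

/-! ## §3 The finite Eisenstein coefficient rings `A_{m,k} = Λ/(q_m, p^k)` -/

namespace IwasawaAlgebra

variable (p : ℕ) [hp : Fact p.Prime]

/-- **`A_{m,k} = Λ ⧸ ((T^m + p) + (p^k))`** — the finite coefficient ring of the `p^k`-torsion of Howard's
specialisation `T_𝔮 = 𝐓 ⊗_Λ S_𝔮`, `S_𝔮 = Λ/(T^m + p)`, at the Eisenstein prime `𝔮 = (T^m + p)`:
`T_𝔮/p^k T_𝔮 = E[p^k] ⊗ A_{m,k}(ψ)` (`#A_{m,k} = p^{km}`, tree `card_quotient_span_qm_sup_span_C_pow`; `T` and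
`p` are nilpotent in it, tree `IwasawaAlgebraEisensteinFiniteQuotientProofs`). An `abbrev` of the quotient ring
in the tree's spelling of the ideal `(q_m, p^k)`. [cite: Howard2004HeegnerKolyvagin, §2.2 and proof of Thm. 2.2.10 (𝔮 = T^m + p)] -/
abbrev EisensteinCoeff (m k : ℕ) : Type :=
  IwasawaAlgebra p ⧸ (Ideal.span {(PowerSeries.X ^ m + PowerSeries.C (p : ℤ_[p]) : IwasawaAlgebra p)} ⊔
    Ideal.span {PowerSeries.C ((p : ℤ_[p]) ^ k)})

namespace EisensteinCoeff

variable {p}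

/-- `p^k` kills every `A_{m,k}`-module (`p^k = 0` in `A_{m,k}`), as an integer scalar.
[cite: Howard2004HeegnerKolyvagin, §2.2] -/
theorem natCast_pow_smul_eq_zero (m k : ℕ) {N : Type w} [AddCommGroup N] [Module (EisensteinCoeff p m k) N]
    (x : N) : ((p : ℤ) ^ k) • x = 0 := by
  rw [← Int.cast_smul_eq_zsmul (EisensteinCoeff p m k) ((p : ℤ) ^ k) x, Int.cast_pow, Int.cast_natCast,
    natCast_pow_eq_zero_quotient p m k, zero_smul]

variable (p) in
/-- **The element `1 + T ∈ A_{m,k}`** — the value `ψ(γ)` of Howard's character `Γ_K ↠ Gal(K_∞/K) → Λˣ`,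
`γ ↦ 1 + T`, in the finite quotient `A_{m,k}` (a unit of `p`-power order there).
[cite: Howard2004HeegnerKolyvagin, §2.2 (Γ_K acts on Λ through γ ↦ γ = 1 + T)] -/
def onePlusT (m k : ℕ) : EisensteinCoeff p m k :=
  Ideal.Quotient.mk _ ((1 : IwasawaAlgebra p) + PowerSeries.X)

/-- Unfolding `onePlusT`: it is the class of `1 + T`. [cite: Howard2004HeegnerKolyvagin, §2.2] -/
theorem onePlusT_def (m k : ℕ) :
    onePlusT p m k = Ideal.Quotient.mk _ ((1 : IwasawaAlgebra p) + PowerSeries.X) := rfl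

/-- **`(1+T)^{p^J} = 1` in `A_{m,k}` for some `J`** (`m ≥ 1`; the unit `1 + T` of the finite ring `A_{m,k}` has
`p`-power order, tree `exists_mk_onePlusX_pow_prime_pow_eq_one`). [cite: Howard2004HeegnerKolyvagin, §2.2 and proof of Thm. 2.2.10 (𝔮 = T^m + p)]
[cite: Washington1997, §13.2 (Lemma 13.7)] -/
theorem exists_onePlusT_pow_prime_pow_eq_one {m : ℕ} (hm : 1 ≤ m) (k : ℕ) :
    ∃ J : ℕ, onePlusT p m k ^ (p ^ J) = 1 :=
  exists_mk_onePlusX_pow_prime_pow_eq_one p hm k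

/-- Hence `(1+T)^{p^J}` acts trivially on every `A_{m,k}`-module for some `J` — the exponent level at which
the `ψ`-twist is computed. [cite: Howard2004HeegnerKolyvagin, §2.2 and proof of Thm. 2.2.10 (𝔮 = T^m + p)] -/
theorem exists_onePlusT_pow_smul_eq {m : ℕ} (hm : 1 ≤ m) (k : ℕ) :
    ∃ J : ℕ, ∀ {N : Type w} [AddCommGroup N] [Module (EisensteinCoeff p m k) N] (x : N),
      onePlusT p m k ^ (p ^ J) • x = x := by
  obtain ⟨J, hJ⟩ := exists_onePlusT_pow_prime_pow_eq_one (p := p) hm k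
  exact ⟨J, fun x ↦ by rw [hJ, one_smul]⟩

variable (p) in
/-- **The carrier `M ⊗ A_{m,k}` of Howard's specialised modules** (`= CoeffExtension ℤ A_{m,k} M = A_{m,k} ⊗_ℤ M`,
the tree's tensor carrier with its discrete topology and `A_{m,k}`-module structure), with the `ℤ`-algebra
structure of `A_{m,k}` PINNED to the generic `Ring.toIntAlgebra` (the one the general constructions
`DiscreteGaloisModule.coeffExtension` / `CoeffExtension.tmul` carry for a variable coefficient ring) — use this
spelling, not `CoeffExtension ℤ (EisensteinCoeff p m k) M`, whose elaborated `ℤ`-algebra instance may differ.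
For `M = E[p^k]`: the underlying group of `T_𝔮/p^k T_𝔮`. [cite: Howard2004HeegnerKolyvagin, §2.2 (T_𝔮 = 𝐓 ⊗_Λ S_𝔮)] -/
abbrev Twisted (m k : ℕ) (M : Type w) [AddCommGroup M] :=
  @CoeffExtension ℤ _ (EisensteinCoeff p m k) _ (Ring.toIntAlgebra _) M _ _

/-- **The pure tensor `c ⊗ a ∈ M ⊗ A_{m,k}`** (the tree's `CoeffExtension.tmul` at the pinned `ℤ`-algebra
structure of `Twisted`). [cite: Howard2004HeegnerKolyvagin, §2.2 (T_𝔮 = 𝐓 ⊗_Λ S_𝔮)] -/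
abbrev Twisted.tmul {m k : ℕ} {M : Type w} [AddCommGroup M] (c : EisensteinCoeff p m k) (a : M) :
    Twisted p m k M :=
  @CoeffExtension.tmul ℤ _ (EisensteinCoeff p m k) _ (Ring.toIntAlgebra _) M _ _ c a

/-- Scalars pass into the first factor of a pure tensor: `c' • (c ⊗ a) = (c' c) ⊗ a` (Mathlib
`TensorProduct.smul_tmul'` at the pinned structure). [cite: Howard2004HeegnerKolyvagin, §2.2 (T_𝔮 = 𝐓 ⊗_Λ S_𝔮)] -/
theorem Twisted.smul_tmul {m k : ℕ} {M : Type w} [AddCommGroup M] (c' c : EisensteinCoeff p m k) (a : M) :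
    c' • Twisted.tmul c a = Twisted.tmul (c' * c) a :=
  TensorProduct.smul_tmul' c' c a

/-- Induction on `M ⊗ A_{m,k}`: zero, pure tensors, sums (the tree's `CoeffExtension.induction_on`).
[cite: Howard2004HeegnerKolyvagin, §2.2 (T_𝔮 = 𝐓 ⊗_Λ S_𝔮)] -/
@[elab_as_elim]
theorem Twisted.induction_on {m k : ℕ} {M : Type w} [AddCommGroup M] {motive : Twisted p m k M → Prop}
    (x : Twisted p m k M) (zero : motive 0) (tmul : ∀ (c : EisensteinCoeff p m k) (a : M), motive (Twisted.tmul c a))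
    (add : ∀ x y, motive x → motive y → motive (x + y)) : motive x :=
  @CoeffExtension.induction_on ℤ _ (EisensteinCoeff p m k) _ (Ring.toIntAlgebra _) M _ _ motive x zero tmul add

end EisensteinCoeff

end IwasawaAlgebra

/-! ## §4 Howard's specialised modules `M ⊗ A_{m,k}(ψ)` (for `M = E[p^k]`: `T_𝔮/p^k T_𝔮`) -/

namespace ZpExtension

variable {K : Type u} [Field K] {p : ℕ} [hp : Fact p.Prime] (κ : ZpExtension K p)
  {M : Type w} [AddCommGroup M] [TopologicalSpace M] [DiscreteTopology M]

/-- The exponent level used for the `ψ`-twist over `A_{m,k}` (any `J` with `(1+T)^{p^J} = 1` in `A_{m,k}`;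
the twist does not depend on the choice, `scalarTwist_apply_eq_of_le`). [cite: Howard2004HeegnerKolyvagin, §2.2] -/
def eisensteinLevel {m : ℕ} (hm : 1 ≤ m) (k : ℕ) : ℕ :=
  Classical.choose (IwasawaAlgebra.EisensteinCoeff.exists_onePlusT_pow_prime_pow_eq_one (p := p) hm k)

/-- Defining property of `eisensteinLevel`: `(1+T)^{p^J} = 1` in `A_{m,k}`. [cite: Howard2004HeegnerKolyvagin, §2.2] -/
theorem onePlusT_pow_prime_pow_eisensteinLevel {m : ℕ} (hm : 1 ≤ m) (k : ℕ) :
    IwasawaAlgebra.EisensteinCoeff.onePlusT p m k ^ (p ^ eisensteinLevel (p := p) hm k) = 1 :=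
  Classical.choose_spec (IwasawaAlgebra.EisensteinCoeff.exists_onePlusT_pow_prime_pow_eq_one (p := p) hm k)

/-- `(1+T)^{p^J}` acts trivially on every `A_{m,k}`-module at `J = eisensteinLevel`. [cite: Howard2004HeegnerKolyvagin, §2.2] -/
theorem onePlusT_pow_prime_pow_eisensteinLevel_smul {m : ℕ} (hm : 1 ≤ m) (k : ℕ) {N : Type w} [AddCommGroup N]
    [Module (IwasawaAlgebra.EisensteinCoeff p m k) N] (x : N) :
    IwasawaAlgebra.EisensteinCoeff.onePlusT p m k ^ (p ^ eisensteinLevel (p := p) hm k) • x = x := by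
  rw [onePlusT_pow_prime_pow_eisensteinLevel, one_smul]

/-- **Howard's specialised module `M ⊗ A_{m,k}(ψ)` at the Eisenstein prime `𝔮 = (T^m + p)`** (`m ≥ 1`): the
discrete Galois module `A_{m,k} ⊗_ℤ M`, `A_{m,k} = Λ/(T^m + p, p^k)`, on which `σ ∈ Γ_K` acts by
`(1+T)^{κ(σ)} ⊗ ρ(σ)` — the scalar twist of `coeffExtension A_{m,k} ρ` by `u = 1 + T`. For
`M = E[p^k]` (`WeierstrassCurve.torsionGaloisModule`) this is `T_𝔮/p^k T_𝔮`, `T_𝔮 = (T_p(E) ⊗ Λ) ⊗_Λ Λ/𝔮`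
with `Γ_K` acting on `Λ` through `Gal(K_∞/K) ∋ γ ↦ 1 + T` [Howard 2004, §2.2; proof of Thm. 2.2.10: "taking
`𝔮 = T^m + p`"], the module whose Selmer groups carry the specialised Kolyvagin system at `𝔮`
[Mazur–Rubin 2004, §5.3]. [cite: Howard2004HeegnerKolyvagin, §2.2, Def. 2.2.3 and proof of Thm. 2.2.10 (𝔮 = T^m + p)]
[cite: MazurRubinMemoirs2004, §5.3] -/
def eisensteinTwist (ρ : DiscreteGaloisModule K M) {m : ℕ} (hm : 1 ≤ m) (k : ℕ) :
    DiscreteGaloisModule K (IwasawaAlgebra.EisensteinCoeff.Twisted p m k M) :=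
  κ.scalarTwist (DiscreteGaloisModule.coeffExtension (IwasawaAlgebra.EisensteinCoeff p m k) ρ)
    (DiscreteGaloisModule.coeffExtension_apply_smul (IwasawaAlgebra.EisensteinCoeff p m k) ρ)
    (eisensteinLevel (p := p) hm k) (IwasawaAlgebra.EisensteinCoeff.onePlusT p m k)
    (onePlusT_pow_prime_pow_eisensteinLevel_smul (p := p) hm k)

variable (ρ : DiscreteGaloisModule K M) {m : ℕ} (hm : 1 ≤ m) (k : ℕ)

/-- Unfolding `eisensteinTwist`: `σ · x = (1+T)^{κ(σ) mod p^J} • (1 ⊗ ρ(σ)) x`, `J = eisensteinLevel`.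
[cite: Howard2004HeegnerKolyvagin, §2.2] -/
theorem eisensteinTwist_apply_apply (σ : absoluteGaloisGroup K)
    (x : IwasawaAlgebra.EisensteinCoeff.Twisted p m k M) :
    κ.eisensteinTwist ρ hm k σ x =
      IwasawaAlgebra.EisensteinCoeff.onePlusT p m k ^ κ.twistExponent (eisensteinLevel (p := p) hm k) σ •
        DiscreteGaloisModule.coeffExtension (IwasawaAlgebra.EisensteinCoeff p m k) ρ σ x :=
  rfl

/-- **Action on pure tensors**: `σ · (c ⊗ a) = ((1+T)^{κ(σ) mod p^J} c) ⊗ ρ(σ) a`.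
[cite: Howard2004HeegnerKolyvagin, §2.2 (T_𝔮 = 𝐓 ⊗_Λ S_𝔮)] -/
theorem eisensteinTwist_apply_tmul (σ : absoluteGaloisGroup K) (c : IwasawaAlgebra.EisensteinCoeff p m k)
    (a : M) :
    κ.eisensteinTwist ρ hm k σ (IwasawaAlgebra.EisensteinCoeff.Twisted.tmul c a) =
      IwasawaAlgebra.EisensteinCoeff.Twisted.tmul
        (IwasawaAlgebra.EisensteinCoeff.onePlusT p m k ^ κ.twistExponent (eisensteinLevel (p := p) hm k) σ * c)
        (ρ σ a) := by
  rw [eisensteinTwist_apply_apply]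
  have h : DiscreteGaloisModule.coeffExtension _ ρ σ (IwasawaAlgebra.EisensteinCoeff.Twisted.tmul c a) =
      IwasawaAlgebra.EisensteinCoeff.Twisted.tmul c (ρ σ a) :=
    DiscreteGaloisModule.coeffExtension_apply_tmul _ ρ σ c a
  rw [h]
  exact IwasawaAlgebra.EisensteinCoeff.Twisted.smul_tmul _ _ _

/-- **`Gal(K̄/K_∞) = ker κ` acts through `ρ`**: `σ · (c ⊗ a) = c ⊗ ρ(σ) a` for `σ ∈ ker κ` (as
`G_{K_∞}`-modules `T_𝔮/p^k = E[p^k] ⊗ A_{m,k}` untwisted). [cite: Howard2004HeegnerKolyvagin, §2.2] -/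
theorem eisensteinTwist_apply_tmul_of_mem_kerSubgroup {σ : absoluteGaloisGroup K} (hσ : σ ∈ κ.kerSubgroup)
    (c : IwasawaAlgebra.EisensteinCoeff p m k) (a : M) :
    κ.eisensteinTwist ρ hm k σ (IwasawaAlgebra.EisensteinCoeff.Twisted.tmul c a) = IwasawaAlgebra.EisensteinCoeff.Twisted.tmul c (ρ σ a) := by
  unfold eisensteinTwist
  rw [κ.scalarTwist_apply_of_mem_kerSubgroup _ _ _ _ _ hσ]
  exact DiscreteGaloisModule.coeffExtension_apply_tmul _ ρ σ c a

/-- **`Gal(K̄/K_J)` acts through `1 ⊗ ρ`** at the exponent level `J = eisensteinLevel` (so the stabilisers of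
the twisted module contain those of `M` intersected with an open subgroup).
[cite: Howard2004HeegnerKolyvagin, §2.2] -/
theorem eisensteinTwist_apply_of_mem_layerSubgroup {σ : absoluteGaloisGroup K}
    (hσ : σ ∈ κ.layerSubgroup (eisensteinLevel (p := p) hm k))
    (x : IwasawaAlgebra.EisensteinCoeff.Twisted p m k M) :
    κ.eisensteinTwist ρ hm k σ x =
      DiscreteGaloisModule.coeffExtension (IwasawaAlgebra.EisensteinCoeff p m k) ρ σ x := by
  unfold eisensteinTwist
  rw [κ.scalarTwist_apply_of_mem_layerSubgroup _ _ _ _ _ hσ]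

/-- **A topological generator `γ` acts by `(1+T) ⊗ ρ(γ)`**: `γ · (c ⊗ a) = ((1+T) c) ⊗ ρ(γ) a` — Howard's
"`Γ_K` acts on `Λ` through `γ ↦ 1 + T`". [cite: Howard2004HeegnerKolyvagin, §2.2 (definition of 𝐓)] -/
theorem eisensteinTwist_apply_tmul_of_isTopGenerator {γ : absoluteGaloisGroup K} (hγ : κ.IsTopGenerator γ)
    (c : IwasawaAlgebra.EisensteinCoeff p m k) (a : M) :
    κ.eisensteinTwist ρ hm k γ (IwasawaAlgebra.EisensteinCoeff.Twisted.tmul c a) =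
      IwasawaAlgebra.EisensteinCoeff.Twisted.tmul (IwasawaAlgebra.EisensteinCoeff.onePlusT p m k * c) (ρ γ a) := by
  unfold eisensteinTwist
  rw [κ.scalarTwist_apply_of_isTopGenerator _ _ _ _ _ hγ]
  have h : DiscreteGaloisModule.coeffExtension _ ρ γ (IwasawaAlgebra.EisensteinCoeff.Twisted.tmul c a) =
      IwasawaAlgebra.EisensteinCoeff.Twisted.tmul c (ρ γ a) :=
    DiscreteGaloisModule.coeffExtension_apply_tmul _ ρ γ c a
  rw [h]
  exact IwasawaAlgebra.EisensteinCoeff.Twisted.smul_tmul _ _ _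

/-- **`Γ_K` acts `A_{m,k}`-linearly on `M ⊗ A_{m,k}(ψ)`** (so its cohomology groups are `A_{m,k}`-, hence
`S_𝔮`- and `Λ`-modules). [cite: Howard2004HeegnerKolyvagin, §2.2 (T_𝔮 is an S_𝔮[Γ_K]-module)] -/
theorem eisensteinTwist_apply_smul (σ : absoluteGaloisGroup K) (c : IwasawaAlgebra.EisensteinCoeff p m k)
    (x : IwasawaAlgebra.EisensteinCoeff.Twisted p m k M) :
    κ.eisensteinTwist ρ hm k σ (c • x) = c • κ.eisensteinTwist ρ hm k σ x := by
  unfold eisensteinTwist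
  exact κ.scalarTwist_apply_smul _ _ _ _ _ σ c x

omit [TopologicalSpace M] [DiscreteTopology M] in
/-- `p^k` kills `M ⊗ A_{m,k}(ψ)` (it is a `p^k`-torsion discrete Galois module, so the tree's Tate duals
`TateDual K · (p^k)` and local Tate pairings modulo `p^k` apply to it). [cite: Howard2004HeegnerKolyvagin, §2.2 and Lemma 2.2.7] -/
theorem prime_pow_smul_eisensteinTwist_carrier
    (x : IwasawaAlgebra.EisensteinCoeff.Twisted p m k M) : ((p : ℤ) ^ k) • x = 0 :=
  IwasawaAlgebra.EisensteinCoeff.natCast_pow_smul_eq_zero m k x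

/-- An element of `ker κ` acting trivially on `M` acts trivially on `M ⊗ A_{m,k}(ψ)` (e.g. inertia at a place
of good reduction away from `p` that is unramified in `K_∞/K`, `M = E[p^k]`).
[cite: Howard2004HeegnerKolyvagin, §2.2 and Lemma 2.2.7 (local conditions at v ∤ p)] -/
theorem eisensteinTwist_apply_eq_self_of_mem_kerSubgroup {σ : absoluteGaloisGroup K} (hσ : σ ∈ κ.kerSubgroup)
    (hσM : ∀ a : M, ρ σ a = a) (x : IwasawaAlgebra.EisensteinCoeff.Twisted p m k M) :
    κ.eisensteinTwist ρ hm k σ x = x := by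
  unfold eisensteinTwist
  rw [κ.scalarTwist_apply_of_mem_kerSubgroup _ _ _ _ _ hσ,
    DiscreteGaloisModule.coeffExtension_apply_eq_self _ ρ hσM]

end ZpExtension

end Literature.NumberTheory.EllipticCurves

end
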